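import Literature.Barriers.Parity.SiegelZeroQuadraticPolynomialsOmegaSums
import Mathlib.Analysis.PSeries
import HarnessLib

/-!
# Granville–Mollin's Theorem 4: the dyadic error sums of §6B ("after some calculation")

Topic `Literature/Barriers/Parity`, summation layer of the proof of
`Literature.Barriers.Parity.GranvilleMollin2000_thm4` (Granville–Mollin, *Rabinowitsch revisited*,
Acta Arith. 96 (2000), Theorem 4, §6B: "Now `∑_{x<p<2x} ω(p)/p ≪ 1/log(d^η)` for `x > d^C`, by
(5.5). Combining these last two bounds to estimate the error term in (6.2), after some
calculation, gives …"). Everything is PROVED; no definition is introduced. Here `d = −q`,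
`ω(p) = ω_{f_d}(p)` (the tree's `polyRootCountMod ![rabinowitschPoly d] p`), windows of primes are
written `(a, b] = (Nat.primesLE b).filter (a < ·)`, and the dyadic blocks are
`(⌊2^j x⌋, ⌊2^{j+1} x⌋]`.

* `sum_omega_block_le_of_chebyshev`, `sum_omega_div_block_le_of_chebyshev` — from the (5.5)-type
  input `∑_{p ≤ t} ω(p) log p ≤ K_c t log t` (`X₀ ≤ t < X₁`) to the block bounds
  `∑_{x < p ≤ 2x} ω(p) ≤ 4 K_c x`, `∑_{x < p ≤ 2x} ω(p)/p ≤ 4 K_c` (`x ≥ 2`, `X₀ ≤ x`, `2x < X₁`).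
* `card_primes_block_le`, `sum_omega_block_le_trivial` — `#(x, 2x] ≤ x + 1`, `∑_{x<p≤2x} ω(p) ≤ 4x`.
* `sum_omega_div_dyadic_le` — `∑_{x < p ≤ 2^J x} ω(p)/p ≤ J B` from block bounds `B`.
* `sum_omega_dyadic_le` — `∑_{x < p ≤ 2^J x} ω(p) ≤ B x (2^J − 1)` from block bounds `B 2^j x`.
* `sum_omega_sqrt_logsq_dyadic_le` — the remainder sum
  `∑_{x < p ≤ 2^J x} ω(p) √(N/p) log²(N/p) ≤ 384 B N^{3/4} (2^J x)^{1/4}` (`2^J x ≤ N`), via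
  `log u ≤ 8 u^{1/8}` and a geometric sum of ratio `2^{1/4}`.
* `sum_omega_div_weight_dyadic_le` — `∑ (ω(p)/p) w(p) ≤ B ∑_{j<J} W_j` for block maxima `W_j`, and
  `sum_min_one_div_sq_le` — `∑_{4 ≤ m ≤ M} min(1, A/m²) ≤ 3√A + 1`, the weights
  `min{1/ϱ_d, (log y/log(N/q))²}` of (6.2) summed over the dyadic scales.

[cite: GranvilleMollin2000, §6B (6.2) and the display after it]
-/

noncomputable section

open Finset Real
open Literature.NumberTheory.Sieve

namespace Literature.Barriers.Parity

/-! ### Block bounds -/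

/-- **Block bound from the (5.5)-type input**: if `∑_{p ≤ ⌊t⌋} ω(p) log p ≤ K_c t log t` for
`X₀ ≤ t < X₁`, then for `x ≥ 2`, `X₀ ≤ x`, `2x < X₁`: `∑_{⌊x⌋ < p ≤ ⌊2x⌋} ω(p) ≤ 4 K_c x`.
[cite: GranvilleMollin2000, §6B] -/
theorem sum_omega_block_le_of_chebyshev {d : ℤ} {Kc X₀ X₁ x : ℝ} (hKc : 0 ≤ Kc)
    (h55 : ∀ t : ℝ, X₀ ≤ t → t < X₁ →
      ∑ p ∈ Nat.primesLE ⌊t⌋₊, (polyRootCountMod ![rabinowitschPoly d] p : ℝ) * Real.log p ≤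
        Kc * (t * Real.log t))
    (hx : 2 ≤ x) (hX₀ : X₀ ≤ x) (hX₁ : 2 * x < X₁) :
    ∑ p ∈ (Nat.primesLE ⌊2 * x⌋₊).filter (fun p => ⌊x⌋₊ < p),
        (polyRootCountMod ![rabinowitschPoly d] p : ℝ) ≤ 4 * Kc * x := by
  have hx1 : 1 < x := by linarith
  have hlogx : 0 < Real.log x := Real.log_pos hx1
  have hM := h55 (2 * x) (by linarith) hX₁
  have h1 := sum_omega_window_le_of_chebyshev (d := d) hx1 hM
  have hlog2x : Real.log (2 * x) ≤ 2 * Real.log x := by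
    rw [Real.log_mul (by norm_num) (by linarith)]
    have : Real.log 2 ≤ Real.log x := Real.log_le_log (by norm_num) hx
    linarith
  calc ∑ p ∈ (Nat.primesLE ⌊2 * x⌋₊).filter (fun p => ⌊x⌋₊ < p),
        (polyRootCountMod ![rabinowitschPoly d] p : ℝ)
      ≤ Kc * (2 * x * Real.log (2 * x)) / Real.log x := h1
    _ ≤ Kc * (2 * x * (2 * Real.log x)) / Real.log x := by
        refine div_le_div_of_nonneg_right ?_ hlogx.le
        exact mul_le_mul_of_nonneg_left (mul_le_mul_of_nonneg_left hlog2x (by linarith)) hKc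
    _ = 4 * Kc * x := by field_simp; ring

/-- The same for `ω(p)/p`: `∑_{⌊x⌋ < p ≤ ⌊2x⌋} ω(p)/p ≤ 4 K_c`. [cite: GranvilleMollin2000, §6B] -/
theorem sum_omega_div_block_le_of_chebyshev {d : ℤ} {Kc X₀ X₁ x : ℝ} (hKc : 0 ≤ Kc)
    (h55 : ∀ t : ℝ, X₀ ≤ t → t < X₁ →
      ∑ p ∈ Nat.primesLE ⌊t⌋₊, (polyRootCountMod ![rabinowitschPoly d] p : ℝ) * Real.log p ≤
        Kc * (t * Real.log t))
    (hx : 2 ≤ x) (hX₀ : X₀ ≤ x) (hX₁ : 2 * x < X₁) :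
    ∑ p ∈ (Nat.primesLE ⌊2 * x⌋₊).filter (fun p => ⌊x⌋₊ < p),
        (polyRootCountMod ![rabinowitschPoly d] p : ℝ) / p ≤ 4 * Kc := by
  have hx1 : 1 < x := by linarith
  have hx0 : 0 < x := by linarith
  have hlogx : 0 < Real.log x := Real.log_pos hx1
  have hM := h55 (2 * x) (by linarith) hX₁
  have h1 := sum_omega_div_window_le_of_chebyshev (d := d) hx1 hM
  have hlog2x : Real.log (2 * x) ≤ 2 * Real.log x := by
    rw [Real.log_mul (by norm_num) (by linarith)]
    have : Real.log 2 ≤ Real.log x := Real.log_le_log (by norm_num) hx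
    linarith
  calc ∑ p ∈ (Nat.primesLE ⌊2 * x⌋₊).filter (fun p => ⌊x⌋₊ < p),
        (polyRootCountMod ![rabinowitschPoly d] p : ℝ) / p
      ≤ Kc * (2 * x * Real.log (2 * x)) / (x * Real.log x) := h1
    _ ≤ Kc * (2 * x * (2 * Real.log x)) / (x * Real.log x) := by
        refine div_le_div_of_nonneg_right ?_ (by positivity)
        exact mul_le_mul_of_nonneg_left (mul_le_mul_of_nonneg_left hlog2x (by linarith)) hKc
    _ = 4 * Kc := by field_simp; ring

/-- A dyadic block of integers contains at most `x + 1` primes: `#(⌊x⌋, ⌊2x⌋] ≤ x + 1` (`x ≥ 0`).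
[folklore] -/
theorem card_primes_block_le {x : ℝ} (hx : 0 ≤ x) :
    (#((Nat.primesLE ⌊2 * x⌋₊).filter (fun p => ⌊x⌋₊ < p)) : ℝ) ≤ x + 1 := by
  have hsub : (Nat.primesLE ⌊2 * x⌋₊).filter (fun p => ⌊x⌋₊ < p) ⊆ Ioc ⌊x⌋₊ ⌊2 * x⌋₊ := by
    intro p hp
    rw [mem_filter, Nat.mem_primesLE] at hp
    exact mem_Ioc.mpr ⟨hp.2, hp.1.1⟩
  have h1 : #((Nat.primesLE ⌊2 * x⌋₊).filter (fun p => ⌊x⌋₊ < p)) ≤ ⌊2 * x⌋₊ - ⌊x⌋₊ := by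
    simpa using card_le_card hsub
  have h2 : (⌊2 * x⌋₊ : ℝ) ≤ 2 * x := Nat.floor_le (by linarith)
  have h3 : x < (⌊x⌋₊ : ℝ) + 1 := Nat.lt_floor_add_one x
  have h4 : ⌊x⌋₊ ≤ ⌊2 * x⌋₊ := Nat.floor_le_floor (by linarith)
  have h5 : ((⌊2 * x⌋₊ - ⌊x⌋₊ : ℕ) : ℝ) = (⌊2 * x⌋₊ : ℝ) - ⌊x⌋₊ := by push_cast [Nat.cast_sub h4]; ring
  calc (#((Nat.primesLE ⌊2 * x⌋₊).filter (fun p => ⌊x⌋₊ < p)) : ℝ) ≤ ((⌊2 * x⌋₊ - ⌊x⌋₊ : ℕ) : ℝ) := by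
        exact_mod_cast h1
    _ ≤ x + 1 := by rw [h5]; linarith

/-- **Trivial block bound**: `∑_{⌊x⌋ < p ≤ ⌊2x⌋} ω(p) ≤ 4x` for `x ≥ 1` (`ω ≤ 2`). [folklore] -/
theorem sum_omega_block_le_trivial {d : ℤ} {q : ℕ} (hdq : d = -(q : ℤ)) (hq4 : q % 4 = 3) {x : ℝ}
    (hx : 1 ≤ x) :
    ∑ p ∈ (Nat.primesLE ⌊2 * x⌋₊).filter (fun p => ⌊x⌋₊ < p),
        (polyRootCountMod ![rabinowitschPoly d] p : ℝ) ≤ 4 * x := by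
  calc ∑ p ∈ (Nat.primesLE ⌊2 * x⌋₊).filter (fun p => ⌊x⌋₊ < p),
        (polyRootCountMod ![rabinowitschPoly d] p : ℝ)
      ≤ ∑ _p ∈ (Nat.primesLE ⌊2 * x⌋₊).filter (fun p => ⌊x⌋₊ < p), (2 : ℝ) := by
        refine sum_le_sum fun p hp => ?_
        exact_mod_cast polyRootCountMod_rabinowitschPoly_le_two hdq hq4
          (Nat.prime_of_mem_primesLE (mem_filter.mp hp).1)
    _ = 2 * #((Nat.primesLE ⌊2 * x⌋₊).filter (fun p => ⌊x⌋₊ < p)) := by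
        rw [sum_const, nsmul_eq_mul, mul_comm]
    _ ≤ 2 * (x + 1) := mul_le_mul_of_nonneg_left (card_primes_block_le (by linarith)) (by norm_num)
    _ ≤ 4 * x := by linarith

/-! ### Dyadic sums with constant weights -/

/-- **Constant weights**: block bounds `∑_{block j} ω(p)/p ≤ B` give `∑_{x < p ≤ 2^J x} ω(p)/p ≤ J B`.
[cite: GranvilleMollin2000, §6B] -/
theorem sum_omega_div_dyadic_le {d : ℤ} {x B : ℝ} (hx : 0 ≤ x) (J : ℕ)
    (hB : ∀ j < J, ∑ p ∈ (Nat.primesLE ⌊(2 : ℝ) ^ (j + 1) * x⌋₊).filter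
      (fun p => ⌊(2 : ℝ) ^ j * x⌋₊ < p), (polyRootCountMod ![rabinowitschPoly d] p : ℝ) / p ≤ B) :
    ∑ p ∈ (Nat.primesLE ⌊(2 : ℝ) ^ J * x⌋₊).filter (fun p => ⌊x⌋₊ < p),
        (polyRootCountMod ![rabinowitschPoly d] p : ℝ) / p ≤ J * B := by
  have h := sum_dyadic_le (a := fun p : ℕ => (polyRootCountMod ![rabinowitschPoly d] p : ℝ) / p)
    (c := fun _ => (1 : ℝ)) (fun p => by positivity) hx (B := fun _ => B) (W := fun _ => (1 : ℝ)) J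
    hB (fun j _ p _ => le_rfl) (fun _ _ => zero_le_one)
  simp only [mul_one, one_mul, sum_const, card_range, nsmul_eq_mul] at h
  exact h

/-- **Counting**: block bounds `∑_{block j} ω(p) ≤ B 2^j x` give `∑_{x < p ≤ 2^J x} ω(p) ≤ B x (2^J − 1)`.
[cite: GranvilleMollin2000, §6B] -/
theorem sum_omega_dyadic_le {d : ℤ} {x B : ℝ} (hx : 0 ≤ x) (J : ℕ)
    (hB : ∀ j < J, ∑ p ∈ (Nat.primesLE ⌊(2 : ℝ) ^ (j + 1) * x⌋₊).filter
      (fun p => ⌊(2 : ℝ) ^ j * x⌋₊ < p), (polyRootCountMod ![rabinowitschPoly d] p : ℝ) ≤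
        B * ((2 : ℝ) ^ j * x)) :
    ∑ p ∈ (Nat.primesLE ⌊(2 : ℝ) ^ J * x⌋₊).filter (fun p => ⌊x⌋₊ < p),
        (polyRootCountMod ![rabinowitschPoly d] p : ℝ) ≤ B * x * ((2 : ℝ) ^ J - 1) := by
  have h := sum_dyadic_le (a := fun p : ℕ => (polyRootCountMod ![rabinowitschPoly d] p : ℝ))
    (c := fun _ => (1 : ℝ)) (fun p => by positivity) hx (B := fun j => B * ((2 : ℝ) ^ j * x))
    (W := fun _ => (1 : ℝ)) J hB (fun j _ p _ => le_rfl) (fun _ _ => zero_le_one)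
  simp only [mul_one, one_mul] at h
  refine h.trans (le_of_eq ?_)
  rw [show ∑ j ∈ range J, B * ((2 : ℝ) ^ j * x) = B * x * ∑ j ∈ range J, (2 : ℝ) ^ j by
    rw [mul_sum]; refine sum_congr rfl fun j _ => ?_; ring]
  rw [geom_sum_eq (by norm_num : (2 : ℝ) ≠ 1)]
  ring

/-! ### The remainder sum `∑ ω(p) √(N/p) log²(N/p)` -/

/-- `log² u ≤ 64 u^{1/4}` for `u ≥ 1` (from `log u ≤ 8 u^{1/8}`, Mathlib's `log_le_rpow_div`). [folklore] -/
theorem log_sq_le_rpow_quarter {u : ℝ} (hu : 1 ≤ u) : Real.log u ^ 2 ≤ 64 * u ^ ((1 : ℝ) / 4) := by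
  have hu0 : 0 ≤ u := by linarith
  have h1 : Real.log u ≤ u ^ ((1 : ℝ) / 8) / ((1 : ℝ) / 8) := Real.log_le_rpow_div hu0 (by norm_num)
  have h2 : Real.log u ≤ 8 * u ^ ((1 : ℝ) / 8) := by rw [div_div_eq_mul_div] at h1; linarith
  have hlog0 : 0 ≤ Real.log u := Real.log_nonneg hu
  have h3 : Real.log u ^ 2 ≤ (8 * u ^ ((1 : ℝ) / 8)) ^ 2 := pow_le_pow_left₀ hlog0 h2 2
  have h4 : (u ^ ((1 : ℝ) / 8)) ^ 2 = u ^ ((1 : ℝ) / 4) := by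
    rw [← Real.rpow_natCast, ← Real.rpow_mul hu0]; norm_num
  calc Real.log u ^ 2 ≤ (8 * u ^ ((1 : ℝ) / 8)) ^ 2 := h3
    _ = 64 * u ^ ((1 : ℝ) / 4) := by rw [mul_pow, h4]; norm_num

/-- `√v log² v ≤ 64 v^{3/4}`, i.e. `√(N/p) log²(N/p) ≤ 64 (N/p)^{1/4} · (N/p)^{1/2}`: for `v ≥ 1`,
`√v · log² v ≤ 64 v^{1/4} √v`. [folklore] -/
theorem sqrt_mul_log_sq_le {v : ℝ} (hv : 1 ≤ v) :
    Real.sqrt v * Real.log v ^ 2 ≤ 64 * v ^ ((3 : ℝ) / 4) := by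
  have hv0 : 0 ≤ v := by linarith
  have h1 := log_sq_le_rpow_quarter hv
  have h2 : Real.sqrt v * (64 * v ^ ((1 : ℝ) / 4)) = 64 * v ^ ((3 : ℝ) / 4) := by
    rw [Real.sqrt_eq_rpow, show (3 : ℝ) / 4 = 1 / 2 + 1 / 4 by norm_num,
      Real.rpow_add' hv0 (by norm_num)]
    ring
  calc Real.sqrt v * Real.log v ^ 2 ≤ Real.sqrt v * (64 * v ^ ((1 : ℝ) / 4)) :=
        mul_le_mul_of_nonneg_left h1 (Real.sqrt_nonneg v)
    _ = 64 * v ^ ((3 : ℝ) / 4) := h2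

/-- **The remainder sum over dyadic blocks**: if `∑_{block j} ω(p) ≤ B 2^j x` for `j < J`, `x ≥ 1`
and `2^J x ≤ N`, then `∑_{x < p ≤ 2^J x} ω(p) √(N/p) log²(N/p) ≤ 384 B N^{3/4} (2^J x)^{1/4}`
(`√v log² v ≤ 64 v^{3/4}` for `v = N/p ≥ 1`, and a geometric sum of ratio `2^{1/4}`).
[cite: GranvilleMollin2000, §6B] -/
theorem sum_omega_sqrt_logsq_dyadic_le {d : ℤ} {x B : ℝ} {N : ℕ} (hx : 1 ≤ x) (hB0 : 0 ≤ B) (J : ℕ)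
    (hJN : (2 : ℝ) ^ J * x ≤ N)
    (hB : ∀ j < J, ∑ p ∈ (Nat.primesLE ⌊(2 : ℝ) ^ (j + 1) * x⌋₊).filter
      (fun p => ⌊(2 : ℝ) ^ j * x⌋₊ < p), (polyRootCountMod ![rabinowitschPoly d] p : ℝ) ≤
        B * ((2 : ℝ) ^ j * x)) :
    ∑ p ∈ (Nat.primesLE ⌊(2 : ℝ) ^ J * x⌋₊).filter (fun p => ⌊x⌋₊ < p),
        (polyRootCountMod ![rabinowitschPoly d] p : ℝ) *
          (Real.sqrt ((N : ℝ) / p) * Real.log ((N : ℝ) / p) ^ 2) ≤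
      384 * B * (N : ℝ) ^ ((3 : ℝ) / 4) * ((2 : ℝ) ^ J * x) ^ ((1 : ℝ) / 4) := by
  have hx0 : 0 < x := by linarith
  have hN0 : (0 : ℝ) ≤ N := Nat.cast_nonneg N
  -- weights `W j = 64 N^{3/4-1/2} …`: we use `c p ≤ 64 (N/p)^{3/4}` and `(N/p) ≤ N/(2^j x)`
  set W : ℕ → ℝ := fun j => 64 * ((N : ℝ) / ((2 : ℝ) ^ j * x)) ^ ((3 : ℝ) / 4) with hW
  have hWnn : ∀ j < J, 0 ≤ W j := fun j _ => by positivity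
  have hWle : ∀ j < J, ∀ p ∈ (Nat.primesLE ⌊(2 : ℝ) ^ (j + 1) * x⌋₊).filter
      (fun p => ⌊(2 : ℝ) ^ j * x⌋₊ < p),
      Real.sqrt ((N : ℝ) / p) * Real.log ((N : ℝ) / p) ^ 2 ≤ W j := by
    intro j hj p hp
    rw [mem_filter, Nat.mem_primesLE] at hp
    have h2j : 0 < (2 : ℝ) ^ j * x := by positivity
    have hp_gt : (2 : ℝ) ^ j * x < p := (Nat.floor_lt h2j.le).mp hp.2
    have hp0 : (0 : ℝ) < p := lt_trans h2j hp_gt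
    have hp_le : (p : ℝ) ≤ (2 : ℝ) ^ (j + 1) * x := by
      have := Nat.floor_le (show 0 ≤ (2 : ℝ) ^ (j + 1) * x by positivity)
      exact le_trans (by exact_mod_cast hp.1.1) this
    have hpN : (p : ℝ) ≤ N := by
      refine hp_le.trans (le_trans ?_ hJN)
      exact mul_le_mul_of_nonneg_right (pow_le_pow_right₀ (by norm_num) hj) hx0.le
    have hv1 : 1 ≤ (N : ℝ) / p := by rw [le_div_iff₀ hp0, one_mul]; exact hpN
    have hv_le : (N : ℝ) / p ≤ (N : ℝ) / ((2 : ℝ) ^ j * x) :=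
      div_le_div_of_nonneg_left hN0 h2j hp_gt.le
    calc Real.sqrt ((N : ℝ) / p) * Real.log ((N : ℝ) / p) ^ 2 ≤ 64 * ((N : ℝ) / p) ^ ((3 : ℝ) / 4) :=
          sqrt_mul_log_sq_le hv1
      _ ≤ 64 * ((N : ℝ) / ((2 : ℝ) ^ j * x)) ^ ((3 : ℝ) / 4) :=
          mul_le_mul_of_nonneg_left (Real.rpow_le_rpow (by positivity) hv_le (by norm_num)) (by norm_num)
  have h := sum_dyadic_le (a := fun p : ℕ => (polyRootCountMod ![rabinowitschPoly d] p : ℝ))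
    (c := fun p : ℕ => Real.sqrt ((N : ℝ) / p) * Real.log ((N : ℝ) / p) ^ 2) (fun p => by positivity)
    hx0.le (B := fun j => B * ((2 : ℝ) ^ j * x)) (W := W) J hB hWle hWnn
  refine h.trans ?_
  -- `W j · B 2^j x = 64 B N^{3/4} (2^j x)^{1/4} = 64 B N^{3/4} x^{1/4} (2^{1/4})^j`
  have hterm : ∀ j ∈ range J, W j * (B * ((2 : ℝ) ^ j * x)) =
      64 * B * (N : ℝ) ^ ((3 : ℝ) / 4) * (x ^ ((1 : ℝ) / 4) * ((2 : ℝ) ^ ((1 : ℝ) / 4)) ^ j) := by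
    intro j _
    have ha : 0 < (2 : ℝ) ^ j * x := by positivity
    have h1 : ((2 : ℝ) ^ j * x) ^ ((3 : ℝ) / 4) * ((2 : ℝ) ^ j * x) ^ ((1 : ℝ) / 4) = (2 : ℝ) ^ j * x := by
      rw [← Real.rpow_add ha]; norm_num
    have h2 : ((2 : ℝ) ^ j * x) ^ ((1 : ℝ) / 4) = x ^ ((1 : ℝ) / 4) * ((2 : ℝ) ^ ((1 : ℝ) / 4)) ^ j := by
      rw [Real.mul_rpow (by positivity) hx0.le, ← Real.rpow_natCast, ← Real.rpow_natCast,
        ← Real.rpow_mul (by norm_num), ← Real.rpow_mul (by norm_num), mul_comm ((1 : ℝ) / 4) (j : ℝ)]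
      ring
    have h3 : ((2 : ℝ) ^ j * x) ^ ((3 : ℝ) / 4) ≠ 0 := (Real.rpow_pos_of_pos ha _).ne'
    have hWj : W j = 64 * ((N : ℝ) ^ ((3 : ℝ) / 4) / ((2 : ℝ) ^ j * x) ^ ((3 : ℝ) / 4)) := by
      simp only [hW, Real.div_rpow hN0 ha.le]
    rw [hWj]
    calc 64 * ((N : ℝ) ^ ((3 : ℝ) / 4) / ((2 : ℝ) ^ j * x) ^ ((3 : ℝ) / 4)) * (B * ((2 : ℝ) ^ j * x))
        = 64 * ((N : ℝ) ^ ((3 : ℝ) / 4) / ((2 : ℝ) ^ j * x) ^ ((3 : ℝ) / 4)) *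
            (B * (((2 : ℝ) ^ j * x) ^ ((3 : ℝ) / 4) * ((2 : ℝ) ^ j * x) ^ ((1 : ℝ) / 4))) := by
          rw [h1]
      _ = 64 * B * (N : ℝ) ^ ((3 : ℝ) / 4) * ((2 : ℝ) ^ j * x) ^ ((1 : ℝ) / 4) := by
          field_simp
      _ = 64 * B * (N : ℝ) ^ ((3 : ℝ) / 4) * (x ^ ((1 : ℝ) / 4) * ((2 : ℝ) ^ ((1 : ℝ) / 4)) ^ j) := by
          rw [h2]
  rw [sum_congr rfl hterm, ← mul_sum, ← mul_sum]
  -- geometric sum of ratio `r = 2^{1/4}`: `(r - 1) ∑_{j<J} r^j = r^J - 1`, `r - 1 ≥ 1/6`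
  set r : ℝ := (2 : ℝ) ^ ((1 : ℝ) / 4) with hr
  have hr1 : 1 < r := Real.one_lt_rpow (by norm_num) (by norm_num)
  have hr4 : r ^ 4 = 2 := by
    rw [hr, ← Real.rpow_natCast, ← Real.rpow_mul (by norm_num)]; norm_num
  -- `r - 1 ≥ 1/6` since `(7/6)^4 < 2`
  have hr6 : (7 : ℝ) / 6 ≤ r := by
    by_contra h
    have h : r < 7 / 6 := not_le.mp h
    have h0 : 0 ≤ r := by positivity
    have : r ^ 4 < ((7 : ℝ) / 6) ^ 4 := pow_lt_pow_left₀ h h0 (by norm_num)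
    rw [hr4] at this
    norm_num at this
  have hgeom : ∑ j ∈ range J, r ^ j = (r ^ J - 1) / (r - 1) := geom_sum_eq hr1.ne' J
  have hsum_le : ∑ j ∈ range J, r ^ j ≤ 6 * r ^ J := by
    rw [hgeom, div_le_iff₀ (by linarith)]
    have : 0 ≤ r ^ J := by positivity
    nlinarith
  -- `r^J = (2^J)^{1/4}` and `x^{1/4} (2^J)^{1/4} = (2^J x)^{1/4}`
  have hrJ : r ^ J = ((2 : ℝ) ^ J) ^ ((1 : ℝ) / 4) := by
    rw [hr, ← Real.rpow_natCast, ← Real.rpow_natCast (2 : ℝ) J, ← Real.rpow_mul (by norm_num),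
      ← Real.rpow_mul (by norm_num), mul_comm]
  have hfinal : 64 * B * (N : ℝ) ^ ((3 : ℝ) / 4) * (x ^ ((1 : ℝ) / 4) * ∑ j ∈ range J, r ^ j) ≤
      64 * B * (N : ℝ) ^ ((3 : ℝ) / 4) * (x ^ ((1 : ℝ) / 4) * (6 * r ^ J)) := by
    refine mul_le_mul_of_nonneg_left (mul_le_mul_of_nonneg_left hsum_le (by positivity)) ?_
    positivity
  refine hfinal.trans (le_of_eq ?_)
  rw [hrJ, Real.mul_rpow (by positivity) hx0.le]
  ring

/-! ### Dyadic sums with decaying weights -/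

/-- **General weights**: block bounds `∑_{block j} ω(p)/p ≤ B` and block maxima `w(p) ≤ W_j`
(`W_j ≥ 0`) give `∑_{x < p ≤ 2^J x} (ω(p)/p) w(p) ≤ B ∑_{j<J} W_j`. [cite: GranvilleMollin2000, §6B] -/
theorem sum_omega_div_weight_dyadic_le {d : ℤ} {x B : ℝ} (hx : 0 ≤ x) (J : ℕ)
    {w : ℕ → ℝ} {W : ℕ → ℝ}
    (hB : ∀ j < J, ∑ p ∈ (Nat.primesLE ⌊(2 : ℝ) ^ (j + 1) * x⌋₊).filter
      (fun p => ⌊(2 : ℝ) ^ j * x⌋₊ < p), (polyRootCountMod ![rabinowitschPoly d] p : ℝ) / p ≤ B)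
    (hW : ∀ j < J, ∀ p ∈ (Nat.primesLE ⌊(2 : ℝ) ^ (j + 1) * x⌋₊).filter
      (fun p => ⌊(2 : ℝ) ^ j * x⌋₊ < p), w p ≤ W j)
    (hW0 : ∀ j < J, 0 ≤ W j) :
    ∑ p ∈ (Nat.primesLE ⌊(2 : ℝ) ^ J * x⌋₊).filter (fun p => ⌊x⌋₊ < p),
        (polyRootCountMod ![rabinowitschPoly d] p : ℝ) / p * w p ≤ B * ∑ j ∈ range J, W j := by
  have h := sum_dyadic_le (a := fun p : ℕ => (polyRootCountMod ![rabinowitschPoly d] p : ℝ) / p)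
    (c := w) (fun p => by positivity) hx (B := fun _ => B) (W := W) J hB hW hW0
  refine h.trans ?_
  rw [mul_sum]
  exact sum_le_sum fun j _ => le_of_eq (mul_comm _ _)

/-- **The weights of (6.2) summed over the scales**: for `A ≥ 0` and `M ≥ 3`,
`∑_{4 ≤ m ≤ M} min(1, A/m²) ≤ 3√A + 1` (at most `√A` terms equal to `1`; the others sum to
`≤ A · 2/(⌊√A⌋ + 1) ≤ 2√A`, Mathlib's `sum_Ioo_inv_sq_le`). [cite: GranvilleMollin2000, §6B] -/
theorem sum_min_one_div_sq_le {A : ℝ} (hA : 0 ≤ A) (M : ℕ) :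
    ∑ m ∈ Ico 4 (M + 1), min 1 (A / (m : ℝ) ^ 2) ≤ 3 * Real.sqrt A + 1 := by
  set s : ℕ := ⌊Real.sqrt A⌋₊ with hs
  have hsA : (s : ℝ) ≤ Real.sqrt A := Nat.floor_le (Real.sqrt_nonneg A)
  have hAs : Real.sqrt A < (s : ℝ) + 1 := Nat.lt_floor_add_one _
  have hsqA : Real.sqrt A ^ 2 = A := Real.sq_sqrt hA
  rw [← sum_filter_add_sum_filter_not (Ico 4 (M + 1)) (fun m : ℕ => m ≤ s)]
  have h1 : ∑ m ∈ (Ico 4 (M + 1)).filter (fun m : ℕ => m ≤ s), min 1 (A / (m : ℝ) ^ 2) ≤ Real.sqrt A := by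
    calc ∑ m ∈ (Ico 4 (M + 1)).filter (fun m : ℕ => m ≤ s), min 1 (A / (m : ℝ) ^ 2)
        ≤ ∑ _m ∈ (Ico 4 (M + 1)).filter (fun m : ℕ => m ≤ s), (1 : ℝ) :=
          sum_le_sum fun m _ => min_le_left _ _
      _ = #((Ico 4 (M + 1)).filter (fun m : ℕ => m ≤ s)) := by rw [sum_const, nsmul_eq_mul, mul_one]
      _ ≤ #(Icc 1 s) := by
          refine Nat.cast_le.mpr (card_le_card fun m hm => ?_)
          rw [mem_filter, mem_Ico] at hm
          exact mem_Icc.mpr ⟨by omega, hm.2⟩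
      _ = s := by simp
      _ ≤ Real.sqrt A := hsA
  have h2 : ∑ m ∈ (Ico 4 (M + 1)).filter (fun m : ℕ => ¬ m ≤ s), min 1 (A / (m : ℝ) ^ 2) ≤
      2 * Real.sqrt A + 1 := by
    calc ∑ m ∈ (Ico 4 (M + 1)).filter (fun m : ℕ => ¬ m ≤ s), min 1 (A / (m : ℝ) ^ 2)
        ≤ ∑ m ∈ (Ico 4 (M + 1)).filter (fun m : ℕ => ¬ m ≤ s), A / (m : ℝ) ^ 2 :=
          sum_le_sum fun m _ => min_le_right _ _
      _ ≤ ∑ m ∈ Ioo s (M + 1), A / (m : ℝ) ^ 2 := by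
          refine sum_le_sum_of_subset_of_nonneg (fun m hm => ?_) (fun m _ _ => by positivity)
          rw [mem_filter, mem_Ico] at hm
          exact mem_Ioo.mpr ⟨by omega, hm.1.2⟩
      _ = A * ∑ m ∈ Ioo s (M + 1), ((m : ℝ) ^ 2)⁻¹ := by
          rw [mul_sum]; refine sum_congr rfl fun m _ => ?_; rw [div_eq_mul_inv]
      _ ≤ A * (2 / ((s : ℝ) + 1)) := mul_le_mul_of_nonneg_left (sum_Ioo_inv_sq_le s (M + 1)) hA
      _ ≤ 2 * Real.sqrt A + 1 := by
          -- `A/(s+1) ≤ √A` since `√A < s + 1`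
          have hs1 : (0 : ℝ) < (s : ℝ) + 1 := by positivity
          rw [mul_div_assoc', div_le_iff₀ hs1]
          nlinarith [Real.sqrt_nonneg A, hsqA]
  linarith

/-- **The remainder sum without logarithms**: if `∑_{block j} ω(p) ≤ B 2^j x` for `j < J` and
`x > 0`, then `∑_{x < p ≤ 2^J x} ω(p) √(N/p) ≤ 3 B √N √(2^J x)` (geometric sum of ratio `√2`).
[cite: GranvilleMollin2000, §6B] -/
theorem sum_omega_sqrt_dyadic_le {d : ℤ} {x B N : ℝ} (hx : 0 < x) (hB0 : 0 ≤ B) (hN : 0 ≤ N) (J : ℕ)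
    (hB : ∀ j < J, ∑ p ∈ (Nat.primesLE ⌊(2 : ℝ) ^ (j + 1) * x⌋₊).filter
      (fun p => ⌊(2 : ℝ) ^ j * x⌋₊ < p), (polyRootCountMod ![rabinowitschPoly d] p : ℝ) ≤
        B * ((2 : ℝ) ^ j * x)) :
    ∑ p ∈ (Nat.primesLE ⌊(2 : ℝ) ^ J * x⌋₊).filter (fun p => ⌊x⌋₊ < p),
        (polyRootCountMod ![rabinowitschPoly d] p : ℝ) * Real.sqrt (N / p) ≤
      3 * B * Real.sqrt N * Real.sqrt ((2 : ℝ) ^ J * x) := by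
  set W : ℕ → ℝ := fun j => Real.sqrt (N / ((2 : ℝ) ^ j * x)) with hW
  have hWnn : ∀ j < J, 0 ≤ W j := fun j _ => Real.sqrt_nonneg _
  have hWle : ∀ j < J, ∀ p ∈ (Nat.primesLE ⌊(2 : ℝ) ^ (j + 1) * x⌋₊).filter
      (fun p => ⌊(2 : ℝ) ^ j * x⌋₊ < p), Real.sqrt (N / p) ≤ W j := by
    intro j _ p hp
    rw [mem_filter] at hp
    have h2j : 0 < (2 : ℝ) ^ j * x := by positivity
    have hp_gt : (2 : ℝ) ^ j * x < p := (Nat.floor_lt h2j.le).mp hp.2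
    exact Real.sqrt_le_sqrt (div_le_div_of_nonneg_left hN h2j hp_gt.le)
  have h := sum_dyadic_le (a := fun p : ℕ => (polyRootCountMod ![rabinowitschPoly d] p : ℝ))
    (c := fun p : ℕ => Real.sqrt (N / p)) (fun p => by positivity)
    hx.le (B := fun j => B * ((2 : ℝ) ^ j * x)) (W := W) J hB hWle hWnn
  refine h.trans ?_
  set r : ℝ := Real.sqrt 2 with hr
  have hr2 : r ^ 2 = 2 := Real.sq_sqrt (by norm_num)
  have hr0 : 0 ≤ r := Real.sqrt_nonneg 2
  have hr14 : (7 : ℝ) / 5 ≤ r := by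
    by_contra h'
    have h' : r < 7 / 5 := not_le.mp h'
    have : r ^ 2 < ((7 : ℝ) / 5) ^ 2 := pow_lt_pow_left₀ h' hr0 (by norm_num)
    rw [hr2] at this
    norm_num at this
  have hr1 : 1 < r := by linarith
  -- `W j * (B 2^j x) = B √N √(2^j x) = B √N √x r^j`
  have hterm : ∀ j ∈ range J, W j * (B * ((2 : ℝ) ^ j * x)) = B * Real.sqrt N * Real.sqrt x * r ^ j := by
    intro j _
    have ha : 0 < (2 : ℝ) ^ j * x := by positivity
    have hsq : Real.sqrt ((2 : ℝ) ^ j * x) * Real.sqrt ((2 : ℝ) ^ j * x) = (2 : ℝ) ^ j * x :=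
      Real.mul_self_sqrt ha.le
    have hsplit : Real.sqrt ((2 : ℝ) ^ j * x) = r ^ j * Real.sqrt x := by
      rw [Real.sqrt_mul (pow_nonneg two_pos.le j) x]
      congr 1
      rw [show (2 : ℝ) ^ j = (r ^ j) ^ 2 by rw [← pow_mul, mul_comm, pow_mul, hr2]]
      exact Real.sqrt_sq (pow_nonneg hr0 j)
    simp only [hW]
    rw [Real.sqrt_div' _ ha.le, div_mul_eq_mul_div]
    rw [show Real.sqrt N * (B * ((2 : ℝ) ^ j * x)) = Real.sqrt N * B * (Real.sqrt ((2 : ℝ) ^ j * x) *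
      Real.sqrt ((2 : ℝ) ^ j * x)) by rw [hsq]; ring]
    have hs0 : Real.sqrt ((2 : ℝ) ^ j * x) ≠ 0 := (Real.sqrt_pos.mpr ha).ne'
    field_simp
    rw [hsplit]
    ring
  rw [sum_congr rfl hterm, ← mul_sum]
  have hgeom : ∑ j ∈ range J, r ^ j = (r ^ J - 1) / (r - 1) := geom_sum_eq hr1.ne' J
  have hsum_le : ∑ j ∈ range J, r ^ j ≤ 3 * r ^ J := by
    rw [hgeom, div_le_iff₀ (by linarith)]
    have : 0 ≤ r ^ J := by positivity
    nlinarith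
  have hrJ : Real.sqrt x * r ^ J = Real.sqrt ((2 : ℝ) ^ J * x) := by
    rw [Real.sqrt_mul (pow_nonneg two_pos.le J) x, mul_comm]
    congr 1
    rw [show (2 : ℝ) ^ J = (r ^ J) ^ 2 by rw [← pow_mul, mul_comm, pow_mul, hr2]]
    exact (Real.sqrt_sq (pow_nonneg hr0 J)).symm
  calc B * Real.sqrt N * Real.sqrt x * ∑ j ∈ range J, r ^ j ≤ B * Real.sqrt N * Real.sqrt x * (3 * r ^ J) :=
        mul_le_mul_of_nonneg_left hsum_le (by positivity)
    _ = 3 * B * Real.sqrt N * (Real.sqrt x * r ^ J) := by ring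
    _ = 3 * B * Real.sqrt N * Real.sqrt ((2 : ℝ) ^ J * x) := by rw [hrJ]

/-- **Dyadic cover**: for `0 < x ≤ u` there is `J` with `u ≤ 2^J x < 2u`. [folklore] -/
theorem exists_pow_two_mul_ge_lt {x u : ℝ} (hx : 0 < x) (hxu : x ≤ u) :
    ∃ J : ℕ, u ≤ (2 : ℝ) ^ J * x ∧ (2 : ℝ) ^ J * x < 2 * u := by
  have hu : 0 < u := lt_of_lt_of_le hx hxu
  set t : ℝ := Real.logb 2 (u / x) with ht
  have ht0 : 0 ≤ t := Real.logb_nonneg (by norm_num) (by rw [le_div_iff₀ hx, one_mul]; exact hxu)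
  have h2t : (2 : ℝ) ^ t = u / x := Real.rpow_logb (by norm_num) (by norm_num) (div_pos hu hx)
  refine ⟨⌈t⌉₊, ?_, ?_⟩
  · have h1 : (2 : ℝ) ^ t ≤ (2 : ℝ) ^ (⌈t⌉₊ : ℝ) :=
      Real.rpow_le_rpow_of_exponent_le (by norm_num) (Nat.le_ceil t)
    rw [Real.rpow_natCast] at h1
    rw [h2t, div_le_iff₀ hx] at h1
    exact h1
  · have h1 : (2 : ℝ) ^ (⌈t⌉₊ : ℝ) < (2 : ℝ) ^ (t + 1) :=
      Real.rpow_lt_rpow_of_exponent_lt (by norm_num) (Nat.ceil_lt_add_one ht0)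
    rw [Real.rpow_natCast, Real.rpow_add (by norm_num), h2t, Real.rpow_one] at h1
    have := mul_lt_mul_of_pos_right h1 hx
    rw [show u / x * 2 * x = 2 * u by field_simp] at this
    exact this

end Literature.Barriers.Parity
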